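import Summits.HubbardSuperconductivity.HubbardSuperconductivity.Theorems.AnisotropyChordTransferFibre3L2SlopeSound

/-!
# Route `AnisotropyChord` / H0 rotor rung, LEVEL 2: first-order (slope) interval arithmetic for `RExpr` — soundness of the
# node operations, part 2 (`⁻¹`, `|·|`, `√`, `min`, `max`, hull, centred bounds)

Continuation of `…L2SlopeSound`: `holdsInv` (`u⁻¹ − v⁻¹ = −u⁻¹v⁻¹(u − v)`), `holdsAbs` (by sign, else
`||u| − |v|| ≤ |u − v|` and the symmetric hull), `holdsSqrt` (`√u − √v = (u − v)/(√u + √v)` when both roots are positive,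
the still case, else the zero-order fallback), `holdsMin`/`holdsMax` (dominance at both points, else "the increment of a
max/min lies between the two increments" and convexity of the hull), the convex-combination rule ★ `holdsHull`, and the
centred bounds ★ `holdsBounds`: `lb ≤ f(x) ≤ ub` once `δ₂ ∈ D₂, δ₃ ∈ D₃`.
Prover seat `hubbard-h0-rotor-p2` g6; helper for piece A = stmt-HubbardSuperconductivity-23918 of rung 19089
(`--supports`, helper class).  Nothing here proves superconductivity in the Hubbard model; generic helper lemmas serving ONE
conditional reduction (the GM₃ ∀L certificate, Level-2 row `N₁`); the rotor TARGET as originally worded stays FALSE (g15 verdict).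
Mathlib + the tree only; no sorry.
-/

set_option linter.dupNamespace false
set_option autoImplicit false

open Literature.Analysis.ValidatedNumerics NonemptyInterval

namespace Summit.HubbardSuperconductivity.HubbardSuperconductivity.Theorems.AnisotropyChord.Transfer.Fibre3.L2

namespace SD

variable {δ2 δ3 : ℝ} {A B : SD} {fx fz gx gz : ℝ}

/-- a point of an interval with an inverse interval is nonzero. -/
theorem ne_zero_of_invI {I J : NonemptyInterval ℚ} {x : ℝ} (hx : x ∈ I.ratCast ℝ) (hJ : I.invI? = some J) : x ≠ 0 := by
  rw [memQ] at hx
  unfold invI? at hJ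
  split_ifs at hJ with h1 h2
  · have : (0 : ℝ) < I.fst := by exact_mod_cast h1
    exact ne_of_gt (this.trans_le hx.1)
  · have : ((I.snd : ℚ) : ℝ) < 0 := by exact_mod_cast h2
    exact ne_of_lt (hx.2.trans_lt this)

/-- reciprocal (`f(x)⁻¹ − f(z)⁻¹ = −f(x)⁻¹f(z)⁻¹(f(x) − f(z))`). -/
theorem holdsInv (prec : ℕ) (hA : A.Holds δ2 δ3 fx fz) {S : SD} (h : A.inv? prec = some S) :
    S.Holds δ2 δ3 fx⁻¹ fz⁻¹ := by
  obtain ⟨a2, ha2, a3, ha3, ar, har, ha⟩ := hA.lin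
  unfold inv? at h
  split at h
  · rename_i C R hC hR
    simp only [Option.some.injEq] at h
    subst h
    have hcz := inv_mem_of_invI? hA.memc hC
    have hrx := inv_mem_of_invI? hA.memr hR
    have hx0 := ne_zero_of_invI hA.memr hR
    have hz0 := ne_zero_of_invI hA.memc hC
    have hw : -(fx⁻¹ * fz⁻¹) ∈ (-(mulZ R C)).ratCast ℝ := isSoundFun_neg (mul_mem_mulZ hrx hcz)
    refine ⟨mem_roundOut prec hcz, mem_roundOut prec hrx,
      ⟨-(fx⁻¹ * fz⁻¹) * a2, mem_roundOut prec (mul_mem_mulZ hw ha2), -(fx⁻¹ * fz⁻¹) * a3,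
        mem_roundOut prec (mul_mem_mulZ hw ha3), -(fx⁻¹ * fz⁻¹) * ar,
        mem_roundOut prec (mul_mem_mulZ hw har), ?_⟩⟩
    have : fx⁻¹ - fz⁻¹ = -(fx⁻¹ * fz⁻¹) * (fx - fz) := by field_simp; ring
    rw [this, ha]; ring
  · exact absurd h (by simp)

/-- absolute value. -/
theorem holdsAbs (hA : A.Holds δ2 δ3 fx fz) : A.abs.Holds δ2 δ3 |fx| |fz| := by
  obtain ⟨a2, ha2, a3, ha3, ar, har, ha⟩ := hA.lin
  have hc := hA.memc
  have hr := hA.memr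
  unfold SD.abs
  split_ifs with h1 h2
  · -- both nonnegative
    have hz : 0 ≤ fz := le_trans (by exact_mod_cast h1.1) (memQ.1 hc).1
    have hx : 0 ≤ fx := le_trans (by exact_mod_cast h1.2) (memQ.1 hr).1
    refine ⟨abs_mem_absI hc, abs_mem_absI hr, ⟨a2, ha2, a3, ha3, ar, har, ?_⟩⟩
    rw [abs_of_nonneg hx, abs_of_nonneg hz, ha]
  · -- both nonpositive
    have hz : fz ≤ 0 := le_trans (memQ.1 hc).2 (by exact_mod_cast h2.1)
    have hx : fx ≤ 0 := le_trans (memQ.1 hr).2 (by exact_mod_cast h2.2)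
    refine ⟨abs_mem_absI hc, abs_mem_absI hr, ⟨-a2, isSoundFun_neg ha2, -a3, isSoundFun_neg ha3, -ar, isSoundFun_neg har, ?_⟩⟩
    rw [abs_of_nonpos hx, abs_of_nonpos hz]
    have : -fx - -fz = -(fx - fz) := by ring
    rw [this, ha]; ring
  · -- general: `|f(x)| − |f(z)| = θ (f(x) − f(z))`, `|θ| ≤ 1`
    have hθ : ∃ θ : ℝ, |θ| ≤ 1 ∧ |fx| - |fz| = θ * (fx - fz) := by
      by_cases hxz : fx = fz
      · exact ⟨0, by simp, by rw [hxz]; ring⟩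
      · refine ⟨(|fx| - |fz|) / (fx - fz), ?_, ?_⟩
        · rw [abs_div, div_le_one (abs_pos.2 (sub_ne_zero.2 hxz))]
          exact abs_abs_sub_abs_le_abs_sub fx fz
        · field_simp [sub_ne_zero.2 hxz]
    obtain ⟨θ, hθ1, hθ2⟩ := hθ
    refine ⟨abs_mem_absI hc, abs_mem_absI hr, ⟨θ * a2, mem_symI ha2 hθ1, θ * a3, mem_symI ha3 hθ1, θ * ar, mem_symI har hθ1, ?_⟩⟩
    rw [hθ2, ha]; ring

/-- square root. -/
theorem holdsSqrt (prec iters : ℕ) (hA : A.Holds δ2 δ3 fx fz) :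
    (A.sqrt prec iters).Holds δ2 δ3 (Real.sqrt fx) (Real.sqrt fz) := by
  obtain ⟨a2, ha2, a3, ha3, ar, har, ha⟩ := hA.lin
  have hC := sqrt_mem_sqrtI prec iters hA.memc
  have hR := sqrt_mem_sqrtI prec iters hA.memr
  have hfb : (⟨A.c.sqrtI prec iters, A.r.sqrtI prec iters, zI, zI, A.r.sqrtI prec iters - A.c.sqrtI prec iters⟩ : SD).Holds
      δ2 δ3 (Real.sqrt fx) (Real.sqrt fz) :=
    ⟨hC, hR, ⟨0, zero_mem_zI, 0, zero_mem_zI, _, isSoundFun₂_sub hR hC, by ring⟩⟩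
  simp only [SD.sqrt]
  split_ifs with h0 h1
  · -- still argument: `f(x) = f(z)`
    simp only [isStill, Bool.and_eq_true, decide_eq_true_eq] at h0
    obtain ⟨⟨e2, e3⟩, ee⟩ := h0
    rw [e2] at ha2; rw [e3] at ha3; rw [ee] at har
    have hxz : fx = fz := by
      have := ha; rw [eq_zero_of_mem_zI ha2, eq_zero_of_mem_zI ha3, eq_zero_of_mem_zI har] at this; linarith
    refine ⟨hC, hR, ⟨0, zero_mem_zI, 0, zero_mem_zI, 0, zero_mem_zI, ?_⟩⟩
    rw [hxz]; ring
  · -- both roots positive: divide by their sum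
    have hzpos : 0 < Real.sqrt fz := lt_of_lt_of_le (by exact_mod_cast h1.1) (memQ.1 hC).1
    have hxpos : 0 < Real.sqrt fx := lt_of_lt_of_le (by exact_mod_cast h1.2) (memQ.1 hR).1
    have hfz : 0 < fz := Real.sqrt_pos.1 hzpos
    have hfx : 0 < fx := Real.sqrt_pos.1 hxpos
    have hsum : Real.sqrt fx + Real.sqrt fz ∈ (A.r.sqrtI prec iters + A.c.sqrtI prec iters).ratCast ℝ :=
      isSoundFun₂_add hR hC
    split
    · rename_i W hW
      have hw := inv_mem_of_invI? hsum hW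
      have hne : Real.sqrt fx + Real.sqrt fz ≠ 0 := ne_of_gt (by positivity)
      refine ⟨hC, hR, ⟨(Real.sqrt fx + Real.sqrt fz)⁻¹ * a2, mem_roundOut prec (mul_mem_mulZ hw ha2),
        (Real.sqrt fx + Real.sqrt fz)⁻¹ * a3, mem_roundOut prec (mul_mem_mulZ hw ha3),
        (Real.sqrt fx + Real.sqrt fz)⁻¹ * ar, mem_roundOut prec (mul_mem_mulZ hw har), ?_⟩⟩
      have key : Real.sqrt fx - Real.sqrt fz = (Real.sqrt fx + Real.sqrt fz)⁻¹ * (fx - fz) := by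
        have hx2 := Real.mul_self_sqrt hfx.le
        have hz2 := Real.mul_self_sqrt hfz.le
        field_simp
        nlinarith
      rw [key, ha]; ring
    · exact hfb
  · exact hfb

/-- the increment of a `max` lies between the two increments. -/
theorem max_sub_max_between (fx fz gx gz : ℝ) :
    Min.min (fx - fz) (gx - gz) ≤ Max.max fx gx - Max.max fz gz ∧
      Max.max fx gx - Max.max fz gz ≤ Max.max (fx - fz) (gx - gz) := by
  constructor
  · rcases le_total fz gz with h | h
    · rw [max_eq_right h]; have := le_max_right fx gx; have := min_le_right (fx - fz) (gx - gz); linarith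
    · rw [max_eq_left h]; have := le_max_left fx gx; have := min_le_left (fx - fz) (gx - gz); linarith
  · rcases le_total fx gx with h | h
    · rw [max_eq_right h]; have := le_max_right fz gz; have := le_max_right (fx - fz) (gx - gz); linarith
    · rw [max_eq_left h]; have := le_max_left fz gz; have := le_max_left (fx - fz) (gx - gz); linarith

/-- the increment of a `min` lies between the two increments. -/
theorem min_sub_min_between (fx fz gx gz : ℝ) :
    Min.min (fx - fz) (gx - gz) ≤ Min.min fx gx - Min.min fz gz ∧
      Min.min fx gx - Min.min fz gz ≤ Max.max (fx - fz) (gx - gz) := by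
  constructor
  · rcases le_total fx gx with h | h
    · rw [min_eq_left h]; have := min_le_left fz gz; have := min_le_left (fx - fz) (gx - gz); linarith
    · rw [min_eq_right h]; have := min_le_right fz gz; have := min_le_right (fx - fz) (gx - gz); linarith
  · rcases le_total fz gz with h | h
    · rw [min_eq_left h]; have := min_le_left fx gx; have := le_max_left (fx - fz) (gx - gz); linarith
    · rw [min_eq_right h]; have := min_le_right fx gx; have := le_max_right (fx - fz) (gx - gz); linarith

/-- the hull data enclose any pair of values whose increment lies between the two increments. -/
theorem hull_lin {w : ℝ} (hA : A.Holds δ2 δ3 fx fz) (hB : B.Holds δ2 δ3 gx gz)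
    (h1 : Min.min (fx - fz) (gx - gz) ≤ w) (h2 : w ≤ Max.max (fx - fz) (gx - gz)) :
    ∃ s2 ∈ (hullI A.s2 B.s2).ratCast ℝ, ∃ s3 ∈ (hullI A.s3 B.s3).ratCast ℝ, ∃ r ∈ (hullI A.e B.e).ratCast ℝ,
      w = s2 * δ2 + s3 * δ3 + r := by
  obtain ⟨a2, ha2, a3, ha3, ar, har, ha⟩ := hA.lin
  obtain ⟨b2, hb2, b3, hb3, br, hbr, hb⟩ := hB.lin
  obtain ⟨θ, h0, h1', hw⟩ := exists_convex_of_between h1 h2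
  refine ⟨θ * a2 + (1 - θ) * b2, convex_mem_hullI ha2 hb2 h0 h1', θ * a3 + (1 - θ) * b3, convex_mem_hullI ha3 hb3 h0 h1',
    θ * ar + (1 - θ) * br, convex_mem_hullI har hbr h0 h1', ?_⟩
  rw [hw, ha, hb]; ring

/-- maximum. -/
theorem holdsMax (hA : A.Holds δ2 δ3 fx fz) (hB : B.Holds δ2 δ3 gx gz) :
    (A.max B).Holds δ2 δ3 (Max.max fx gx) (Max.max fz gz) := by
  have hcA := memQ.1 hA.memc; have hrA := memQ.1 hA.memr; have hcB := memQ.1 hB.memc; have hrB := memQ.1 hB.memr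
  unfold SD.max
  split_ifs with h1 h2
  · have hx : gx ≤ fx := hrB.2.trans ((by exact_mod_cast h1.1 : ((B.r.snd : ℚ) : ℝ) ≤ A.r.fst).trans hrA.1)
    have hz : gz ≤ fz := hcB.2.trans ((by exact_mod_cast h1.2 : ((B.c.snd : ℚ) : ℝ) ≤ A.c.fst).trans hcA.1)
    rw [max_eq_left hx, max_eq_left hz]; exact hA
  · have hx : fx ≤ gx := hrA.2.trans ((by exact_mod_cast h2.1 : ((A.r.snd : ℚ) : ℝ) ≤ B.r.fst).trans hrB.1)
    have hz : fz ≤ gz := hcA.2.trans ((by exact_mod_cast h2.2 : ((A.c.snd : ℚ) : ℝ) ≤ B.c.fst).trans hcB.1)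
    rw [max_eq_right hx, max_eq_right hz]; exact hB
  · obtain ⟨l1, l2⟩ := max_sub_max_between fx fz gx gz
    exact ⟨max_mem_maxI hA.memc hB.memc, max_mem_maxI hA.memr hB.memr, hull_lin hA hB l1 l2⟩

/-- minimum. -/
theorem holdsMin (hA : A.Holds δ2 δ3 fx fz) (hB : B.Holds δ2 δ3 gx gz) :
    (A.min B).Holds δ2 δ3 (Min.min fx gx) (Min.min fz gz) := by
  have hcA := memQ.1 hA.memc; have hrA := memQ.1 hA.memr; have hcB := memQ.1 hB.memc; have hrB := memQ.1 hB.memr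
  unfold SD.min
  split_ifs with h1 h2
  · have hx : fx ≤ gx := hrA.2.trans ((by exact_mod_cast h1.1 : ((A.r.snd : ℚ) : ℝ) ≤ B.r.fst).trans hrB.1)
    have hz : fz ≤ gz := hcA.2.trans ((by exact_mod_cast h1.2 : ((A.c.snd : ℚ) : ℝ) ≤ B.c.fst).trans hcB.1)
    rw [min_eq_left hx, min_eq_left hz]; exact hA
  · have hx : gx ≤ fx := hrB.2.trans ((by exact_mod_cast h2.1 : ((B.r.snd : ℚ) : ℝ) ≤ A.r.fst).trans hrA.1)
    have hz : gz ≤ fz := hcB.2.trans ((by exact_mod_cast h2.2 : ((B.c.snd : ℚ) : ℝ) ≤ A.c.fst).trans hcA.1)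
    rw [min_eq_right hx, min_eq_right hz]; exact hB
  · obtain ⟨l1, l2⟩ := min_sub_min_between fx fz gx gz
    exact ⟨min_mem_minI hA.memc hB.memc, min_mem_minI hA.memr hB.memr, hull_lin hA hB l1 l2⟩

/-- ★ a CONVEX COMBINATION of two enclosed functions is enclosed by the hull of their data (used for quantities known
only to lie between two bracketing terms). -/
theorem holdsHull {θ : ℝ} (hA : A.Holds δ2 δ3 fx fz) (hB : B.Holds δ2 δ3 gx gz) (h0 : 0 ≤ θ) (h1 : θ ≤ 1) :
    (A.hull B).Holds δ2 δ3 (θ * fx + (1 - θ) * gx) (θ * fz + (1 - θ) * gz) := by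
  obtain ⟨a2, ha2, a3, ha3, ar, har, ha⟩ := hA.lin
  obtain ⟨b2, hb2, b3, hb3, br, hbr, hb⟩ := hB.lin
  refine ⟨convex_mem_hullI hA.memc hB.memc h0 h1, convex_mem_hullI hA.memr hB.memr h0 h1,
    ⟨θ * a2 + (1 - θ) * b2, convex_mem_hullI ha2 hb2 h0 h1, θ * a3 + (1 - θ) * b3, convex_mem_hullI ha3 hb3 h0 h1,
      θ * ar + (1 - θ) * br, convex_mem_hullI har hbr h0 h1, ?_⟩⟩
  have : θ * fx + (1 - θ) * gx - (θ * fz + (1 - θ) * gz) = θ * (fx - fz) + (1 - θ) * (gx - gz) := by ring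
  rw [this, ha, hb]; ring

/-- ★ the centred bounds: `lb ≤ f(x) ≤ ub` once the increments lie in `(D₂, D₃)`. -/
theorem holdsBounds (hA : A.Holds δ2 δ3 fx fz) {D2 D3 : NonemptyInterval ℚ} (h2 : δ2 ∈ D2.ratCast ℝ)
    (h3 : δ3 ∈ D3.ratCast ℝ) : ((A.lb D2 D3 : ℚ) : ℝ) ≤ fx ∧ fx ≤ ((A.ub D2 D3 : ℚ) : ℝ) := by
  obtain ⟨a2, ha2, a3, ha3, ar, har, ha⟩ := hA.lin
  have hmem : fz + (a2 * δ2 + a3 * δ3 + ar) ∈ (A.c + A.lin D2 D3).ratCast ℝ :=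
    isSoundFun₂_add hA.memc (isSoundFun₂_add (isSoundFun₂_add (mul_mem_mulZ ha2 h2) (mul_mem_mulZ ha3 h3)) har)
  have hfx : fx = fz + (a2 * δ2 + a3 * δ3 + ar) := by rw [← ha]; ring
  rw [← hfx] at hmem
  exact memQ.1 hmem

end SD

end Summit.HubbardSuperconductivity.HubbardSuperconductivity.Theorems.AnisotropyChord.Transfer.Fibre3.L2
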